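import Literature.Probability.RandomPlanarGeometry.ConformalRectangleShift
import Literature.Probability.RandomPlanarGeometry.PlanarDomainsTopology
import HarnessLib

/-!
# Conformal rectangles from four boundary parameters; inserting a marked point into a 3-marked domain

Topic `Literature/Probability/RandomPlanarGeometry`; family `conformal-planar`. Two pieces of pure
bookkeeping about marked Jordan domains (`PlanarDomains.lean`):

* `JordanDomain.exists_conformalRectangle_of_lt`: four boundary parameters in cyclic order,
  `t₀ < t₁ < t₂ < t₃ < t₀ + 1`, of a Jordan domain `Ω` are the marks of a conformal rectangle on
  `Ω` — same carrier, boundary loop re-based at `t₀` (`v ↦ boundary (v + t₀)`), marks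
  `(0, t₁ - t₀, t₂ - t₀, t₃ - t₀)` — whose arcs are the four parameter arcs
  `boundary '' [t₀, t₁], …, boundary '' [t₃, t₀ + 1]` (the template is the cyclic re-marking
  `MarkedDomain.exists_shiftMarks` of `ConformalRectangleShift.lean`);
* `MarkedDomain.exists_insertMark`: for a `3`-marked domain `D = (Ω; P₀, P₁, P₂)` (arcs
  `Aᵢ = [Pᵢ, Pᵢ₊₁]`) and a parameter `u` strictly inside the parameter interval of the arc `Aᵢ`,
  the conformal rectangle `(Ω; z, Pᵢ₊₁, Pᵢ₊₂, Pᵢ)` with `z = boundary u` exists: its arcs are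
  `[z, Pᵢ₊₁] ⊆ Aᵢ`, `Aᵢ₊₁`, `Aᵢ₊₂` and `[Pᵢ, z] ⊆ Aᵢ` — the 4-marked domain obtained by splitting
  the arc `Aᵢ` at its interior point `z`, used when a boundary point of a 3-marked domain has to
  serve as a corner (Bollobás–Riordan, *Percolation* (2006), Ch. 7, proof of Claim 23, p. 201:
  the separating probabilities `f^{i+1}`, `f^{i+2}` near `z ∈ Aᵢ` are crossing probabilities of
  this rectangle).

Stated as existence theorems (no new definition), like `exists_shiftMarks`.

## References

* B. Bollobás, O. Riordan, *Percolation*, Cambridge University Press (2006), Ch. 7 p. 201.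
* W. Werner, *Lectures on two-dimensional critical percolation*, IAS/Park City (2007), §3.

## Mathlib / tree

Mathlib: `Set.image_add_const_Icc`, `Fin.strictMono_iff_lt_succ`, `IsPathConnected.joinedIn`. Tree: `PlanarDomains`
(`MarkedDomain.arc`, `pt`, `nextMark`), `PlanarDomainsTopology` (`nextMark_of_lt`,
`nextMark_of_not_lt`), `CollarDomain` (`nextMarks_eq`), `Crosscut` (`JordanDomain.injOn_boundary_Ico`).
-/

noncomputable section

open Set

namespace Literature.Probability.RandomPlanarGeometry

namespace JordanDomain

/-- **A conformal rectangle from four cyclically ordered boundary parameters.** For a Jordan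
domain `Ω` and parameters `t₀ < t₁ < t₂ < t₃ < t₀ + 1` there is a conformal rectangle with carrier
`Ω`, boundary loop `v ↦ boundary (v + t₀)` and marks `(0, t₁ - t₀, t₂ - t₀, t₃ - t₀)`; its first
marked point is `boundary t₀` and its arcs are `boundary '' [t₀, t₁]`, `boundary '' [t₁, t₂]`,
`boundary '' [t₂, t₃]`, `boundary '' [t₃, t₀ + 1]` (Werner 2007, §3: a conformal rectangle is a
Jordan domain with four boundary points in cyclic order). [folklore] -/
theorem exists_conformalRectangle_of_lt (J : JordanDomain) {t₀ t₁ t₂ t₃ : ℝ} (h₁ : t₀ < t₁)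
    (h₂ : t₁ < t₂) (h₃ : t₂ < t₃) (h₄ : t₃ < t₀ + 1) :
    ∃ R : ConformalRectangle, R.carrier = J.carrier ∧ (∀ v, R.boundary v = J.boundary (v + t₀)) ∧
      (∀ k, R.mark k = ![0, t₁ - t₀, t₂ - t₀, t₃ - t₀] k) ∧ R.pt 0 = J.boundary t₀ ∧
      R.arc 0 = J.boundary '' Icc t₀ t₁ ∧ R.arc 1 = J.boundary '' Icc t₁ t₂ ∧
      R.arc 2 = J.boundary '' Icc t₂ t₃ ∧ R.arc 3 = J.boundary '' Icc t₃ (t₀ + 1) := by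
  have him : ∀ a b : ℝ, (fun u => J.boundary (u + t₀)) '' Icc a b =
      J.boundary '' Icc (a + t₀) (b + t₀) := fun a b => by
    rw [show (fun u => J.boundary (u + t₀)) = J.boundary ∘ fun u => u + t₀ from rfl, image_comp,
      image_add_const_Icc]
  let R : ConformalRectangle :=
    { carrier := J.carrier
      boundary := fun u => J.boundary (u + t₀)
      isOpen := J.isOpen
      isBounded := J.isBounded
      isConnected := J.isConnected
      continuous_boundary := J.continuous_boundary.comp (continuous_id.add continuous_const)
      periodic_boundary := J.periodic_boundary.add_const _
      injOn_boundary := fun s hs t ht hst => add_right_cancel (J.injOn_boundary_Ico t₀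
        (show s + t₀ ∈ Ico t₀ (t₀ + 1) from ⟨by linarith [hs.1], by linarith [hs.2]⟩)
        (show t + t₀ ∈ Ico t₀ (t₀ + 1) from ⟨by linarith [ht.1], by linarith [ht.2]⟩) hst)
      range_boundary := by
        rw [show (fun u => J.boundary (u + t₀)) = J.boundary ∘ fun u => u + t₀ from rfl,
          (add_right_surjective _).range_comp]
        exact J.range_boundary
      mark := ![0, t₁ - t₀, t₂ - t₀, t₃ - t₀]
      strictMono_mark := Fin.strictMono_iff_lt_succ.2 fun k => by
        fin_cases k
        · show (0 : ℝ) < t₁ - t₀; linarith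
        · show t₁ - t₀ < t₂ - t₀; linarith
        · show t₂ - t₀ < t₃ - t₀; linarith
      mark_mem := fun k => by
        fin_cases k
        · show (0 : ℝ) ∈ Ico 0 1; exact ⟨le_rfl, one_pos⟩
        · show t₁ - t₀ ∈ Ico 0 1; exact ⟨by linarith, by linarith⟩
        · show t₂ - t₀ ∈ Ico 0 1; exact ⟨by linarith, by linarith⟩
        · show t₃ - t₀ ∈ Ico 0 1; exact ⟨by linarith, by linarith⟩ }
  obtain ⟨n0', n1', n2', n3'⟩ := R.nextMarks_eq
  refine ⟨R, rfl, fun v => rfl, fun k => rfl, ?_, ?_, ?_, ?_, ?_⟩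
  · show J.boundary (0 + t₀) = J.boundary t₀
    rw [zero_add]
  · show R.boundary '' Icc (R.mark 0) (R.nextMark 0) = J.boundary '' Icc t₀ t₁
    rw [n0']
    show (fun u => J.boundary (u + t₀)) '' Icc 0 (t₁ - t₀) = _
    rw [him]; congr 2 <;> ring
  · show R.boundary '' Icc (R.mark 1) (R.nextMark 1) = J.boundary '' Icc t₁ t₂
    rw [n1']
    show (fun u => J.boundary (u + t₀)) '' Icc (t₁ - t₀) (t₂ - t₀) = _
    rw [him]; congr 2 <;> ring
  · show R.boundary '' Icc (R.mark 2) (R.nextMark 2) = J.boundary '' Icc t₂ t₃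
    rw [n2']
    show (fun u => J.boundary (u + t₀)) '' Icc (t₂ - t₀) (t₃ - t₀) = _
    rw [him]; congr 2 <;> ring
  · show R.boundary '' Icc (R.mark 3) (R.nextMark 3) = J.boundary '' Icc t₃ (t₀ + 1)
    rw [n3']
    show (fun u => J.boundary (u + t₀)) '' Icc (t₃ - t₀) (0 + 1) = _
    rw [him]; congr 2 <;> ring

end JordanDomain

namespace MarkedDomain

/-- The marks of a `3`-marked domain, unfolded: `0 ≤ m₀ < m₁ < m₂ < m₀ + 1`. [folklore] -/
theorem marks_chain_three (D : MarkedDomain 3) :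
    0 ≤ D.mark 0 ∧ D.mark 0 < D.mark 1 ∧ D.mark 1 < D.mark 2 ∧ D.mark 2 < D.mark 0 + 1 := by
  refine ⟨(D.mark_mem 0).1, D.strictMono_mark (by decide), D.strictMono_mark (by decide), ?_⟩
  have := (D.mark_mem 2).2; have := (D.mark_mem 0).1; linarith

/-- The next marks of a `3`-marked domain, unfolded. [folklore] -/
theorem nextMarks_eq_three (D : MarkedDomain 3) :
    D.nextMark 0 = D.mark 1 ∧ D.nextMark 1 = D.mark 2 ∧ D.nextMark 2 = D.mark 0 + 1 :=
  ⟨D.nextMark_of_lt 0 (by decide), D.nextMark_of_lt 1 (by decide), D.nextMark_of_not_lt 2 (by decide)⟩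

/-- **Inserting a marked point into an arc of a `3`-marked domain.** Let `D = (Ω; P₀, P₁, P₂)` be
a `3`-marked domain with arcs `Aᵢ = [Pᵢ, Pᵢ₊₁]`, and let `u` lie strictly inside the parameter
interval `(mark i, nextMark i)` of the arc `Aᵢ`, `z = boundary u`. Then the conformal rectangle
`(Ω; z, Pᵢ₊₁, Pᵢ₊₂, Pᵢ)` exists: a conformal rectangle with the same carrier, first marked point
`z`, and arcs `boundary '' [u, nextMark i]` (from `z` to `Pᵢ₊₁`, inside `Aᵢ`), `Aᵢ₊₁`, `Aᵢ₊₂`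
and `boundary '' [mark i, u]` (from `Pᵢ` to `z`, inside `Aᵢ`). This is the 4-marked domain in
which Bollobás–Riordan read the separating events near a point of `Aᵢ` as crossing events
(proof of Claim 23, Ch. 7 p. 201). [folklore] -/
theorem exists_insertMark (D : MarkedDomain 3) (i : Fin 3) {u : ℝ}
    (hu : u ∈ Ioo (D.mark i) (D.nextMark i)) :
    ∃ R : ConformalRectangle, R.carrier = D.carrier ∧ R.pt 0 = D.boundary u ∧
      R.arc 0 = D.boundary '' Icc u (D.nextMark i) ∧ R.arc 1 = D.arc (i + 1) ∧
      R.arc 2 = D.arc (i + 2) ∧ R.arc 3 = D.boundary '' Icc (D.mark i) u := by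
  obtain ⟨h0, h1, h2, h3⟩ := D.marks_chain_three
  obtain ⟨n0, n1, n2⟩ := D.nextMarks_eq_three
  -- shifting a parameter interval by the period does not change the arc it parametrises
  have hper : ∀ a b : ℝ, D.boundary '' Icc (a + 1) (b + 1) = D.boundary '' Icc a b := fun a b => by
    have hp : D.boundary = D.boundary ∘ fun v => v + 1 :=
      funext fun v => (D.periodic_boundary v).symm
    conv_rhs => rw [hp, image_comp, image_add_const_Icc]
  obtain ⟨hu1, hu2⟩ := hu
  fin_cases i
  · -- `i = 0`: the chain `u < m₁ < m₂ < m₀ + 1 < u + 1`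
    simp only [Fin.zero_eta, Fin.isValue] at hu1 hu2 ⊢
    rw [n0] at hu2 ⊢
    obtain ⟨R, hc, -, -, hpt, a0, a1, a2, a3⟩ :=
      D.toJordanDomain.exists_conformalRectangle_of_lt hu2 h2 h3 (by linarith)
    refine ⟨R, hc, hpt, a0, ?_, ?_, ?_⟩
    · rw [a1]
      show _ = D.boundary '' Icc (D.mark 1) (D.nextMark 1)
      rw [n1]
    · rw [a2]
      show _ = D.boundary '' Icc (D.mark 2) (D.nextMark 2)
      rw [n2]
    · rw [a3, hper]
  · -- `i = 1`: the chain `u < m₂ < m₀ + 1 < m₁ + 1 < u + 1`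
    simp only [Fin.mk_one, Fin.isValue] at hu1 hu2 ⊢
    rw [n1] at hu2 ⊢
    obtain ⟨R, hc, -, -, hpt, a0, a1, a2, a3⟩ :=
      D.toJordanDomain.exists_conformalRectangle_of_lt hu2 h3 (by linarith : D.mark 0 + 1 < D.mark 1 + 1)
        (by linarith)
    refine ⟨R, hc, hpt, a0, ?_, ?_, ?_⟩
    · rw [a1]
      show _ = D.boundary '' Icc (D.mark 2) (D.nextMark 2)
      rw [n2]
    · rw [a2, hper]
      show _ = D.boundary '' Icc (D.mark 0) (D.nextMark 0)
      rw [n0]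
    · rw [a3, hper]
  · -- `i = 2`: the chain `u < m₀ + 1 < m₁ + 1 < m₂ + 1 < u + 1`
    simp only [Fin.reduceFinMk, Fin.isValue] at hu1 hu2 ⊢
    rw [n2] at hu2 ⊢
    obtain ⟨R, hc, -, -, hpt, a0, a1, a2, a3⟩ :=
      D.toJordanDomain.exists_conformalRectangle_of_lt hu2
        (by linarith : D.mark 0 + 1 < D.mark 1 + 1) (by linarith : D.mark 1 + 1 < D.mark 2 + 1)
        (by linarith)
    refine ⟨R, hc, hpt, a0, ?_, ?_, ?_⟩
    · rw [a1, hper]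
      show _ = D.boundary '' Icc (D.mark 0) (D.nextMark 0)
      rw [n0]
    · rw [a2, hper]
      show _ = D.boundary '' Icc (D.mark 1) (D.nextMark 1)
      rw [n1]
    · rw [a3, hper]

/-- Two points of one boundary arc are joined by a path inside that arc (the arc is the continuous
image of a compact interval). [folklore] -/
theorem joinedIn_arc {n : ℕ} (D : MarkedDomain n) (k : Fin n) {x y : ℂ} (hx : x ∈ D.arc k)
    (hy : y ∈ D.arc k) : JoinedIn (D.arc k) x y :=
  (((convex_Icc (D.mark k) (D.nextMark k)).isPathConnected
    (nonempty_Icc.2 (D.mark_lt_nextMark k).le)).image D.continuous_boundary).joinedIn x hx y hy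

/-- The two end arcs of the inserted-mark rectangle lie in the split arc `Aᵢ`. [folklore] -/
theorem image_Icc_subset_arc_of_mem_Ioo (D : MarkedDomain 3) (i : Fin 3) {u : ℝ}
    (hu : u ∈ Ioo (D.mark i) (D.nextMark i)) :
    D.boundary '' Icc u (D.nextMark i) ⊆ D.arc i ∧ D.boundary '' Icc (D.mark i) u ⊆ D.arc i :=
  ⟨image_mono (Icc_subset_Icc_left hu.1.le), image_mono (Icc_subset_Icc_right hu.2.le)⟩

end MarkedDomain

end Literature.Probability.RandomPlanarGeometry

end
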